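import Summits.AtomisticToContinuum.Crystallization.Theorems.OverbindingBudgetEnergyLayerProfile

/-!
# OverbindingBudget · decomp-a2c lens-4 g34 — part XXII-S: counting sites of a separated / covering set in a cube (for THIN)

Helper file under `--supports stmt-AtomisticToContinuum-31280` (RDEF = `Theses.OverbindingBudget.RobustDefectLimitWindows`); closes nothing.

The two elementary counts behind THIN `LayerProfileThin` (part Q): for a finite `δ`-separated set `F` of sites in the half-open coordinate cube
`Q(c, ℓ) = {z | c_i ≤ z_i < c_i + ℓ}`:
* SHELL PACKING `card_filter_shell_le` — the sites within coordinate distance `R₀` of `∂Q` number at most `9·(ℓ/R₀ + 1)²·(4R₀/δ + 1)³ = O(ℓ²)`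
  (grid of side `R₀`: each grid box holds `≤ (4R₀/δ+1)³` sites by the ball packing count `card_le_of_separated_of_dist_le`, and the shell meets
  `≤ 9(K+1)²` boxes);
* BULK COVERING `card_ge_of_covering` — if every point of space is within `R₁ < 2` of the configuration `Y`, then `#(Y ∩ Q(c, ℓ)) ≥ (ℓ/4 − 2)³` for
  `ℓ ≥ 8` (one site in each open box of side `4` of a grid inside the cube, all distinct).
-/

noncomputable section

namespace Summit.AtomisticToContinuum.Crystallization.Theorems.OverbindingBudgetEnergyCubeCounting

open Real Finset
open Literature.MathematicalPhysics.StatisticalMechanics (card_le_of_separated_of_dist_le)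
open Summit.AtomisticToContinuum.Crystallization.Theorems.ChartedPlanarOrderChunkFloor (E3)

/-! ## §1 The grid of side `R₀` based at the cube's corner -/

/-- the grid index of a point: `⌊(z_i − c_i)/R₀⌋` coordinatewise (as naturals; meaningful for `z ≥ c`). -/
def gridIdx (c : E3) (R₀ : ℝ) (z : E3) : Fin 3 → ℕ := fun i => (⌊(z i - c i) / R₀⌋).toNat

/-- the grid index as an integer is the floor. [this file] -/
theorem gridIdx_cast {c z : E3} {R₀ : ℝ} (hR₀ : 0 < R₀) (i : Fin 3) (hz : c i ≤ z i) :
    ((gridIdx c R₀ z i : ℕ) : ℤ) = ⌊(z i - c i) / R₀⌋ := by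
  have h0 : 0 ≤ ⌊(z i - c i) / R₀⌋ := Int.floor_nonneg.2 (div_nonneg (sub_nonneg.2 hz) hR₀.le)
  simp [gridIdx, Int.toNat_of_nonneg h0]

/-- the grid box of a point: `k_i R₀ ≤ z_i − c_i < (k_i + 1) R₀`. [this file] -/
theorem gridIdx_bounds {c z : E3} {R₀ : ℝ} (hR₀ : 0 < R₀) (i : Fin 3) (hz : c i ≤ z i) :
    (gridIdx c R₀ z i : ℝ) * R₀ ≤ z i - c i ∧ z i - c i < ((gridIdx c R₀ z i : ℝ) + 1) * R₀ := by
  have hk : (gridIdx c R₀ z i : ℝ) = ((⌊(z i - c i) / R₀⌋ : ℤ) : ℝ) := by exact_mod_cast gridIdx_cast hR₀ i hz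
  rw [hk]
  constructor
  · have := Int.floor_le ((z i - c i) / R₀)
    rwa [le_div_iff₀ hR₀] at this
  · have := Int.lt_floor_add_one ((z i - c i) / R₀)
    rwa [div_lt_iff₀ hR₀] at this

/-- two points of the cube's corner orthant with the same grid index are within `2R₀`. [this file] -/
theorem dist_le_of_gridIdx_eq {c z z' : E3} {R₀ : ℝ} (hR₀ : 0 < R₀) (hz : ∀ i, c i ≤ z i) (hz' : ∀ i, c i ≤ z' i)
    (h : gridIdx c R₀ z = gridIdx c R₀ z') : dist z z' ≤ 2 * R₀ := by
  have hcoord : ∀ i, dist (z i) (z' i) ^ 2 ≤ R₀ ^ 2 := by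
    intro i
    obtain ⟨l1, u1⟩ := gridIdx_bounds hR₀ i (hz i)
    obtain ⟨l2, u2⟩ := gridIdx_bounds hR₀ i (hz' i)
    rw [show gridIdx c R₀ z i = gridIdx c R₀ z' i from congrFun h i] at l1 u1
    have hab : |z i - z' i| ≤ R₀ := by rw [abs_sub_le_iff]; constructor <;> linarith
    rw [Real.dist_eq]
    exact pow_le_pow_left₀ (abs_nonneg _) hab 2
  rw [EuclideanSpace.dist_eq]
  have hsum : ∑ i, dist (z i) (z' i) ^ 2 ≤ (2 * R₀) ^ 2 := by
    calc ∑ i, dist (z i) (z' i) ^ 2 ≤ ∑ _i : Fin 3, R₀ ^ 2 := sum_le_sum fun i _ => hcoord i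
      _ = 3 * R₀ ^ 2 := by simp
      _ ≤ (2 * R₀) ^ 2 := by nlinarith
  calc √(∑ i, dist (z i) (z' i) ^ 2) ≤ √((2 * R₀) ^ 2) := Real.sqrt_le_sqrt hsum
    _ = 2 * R₀ := Real.sqrt_sq (by positivity)

/-- **box packing**: a `δ`-separated set has at most `(4R₀/δ + 1)³` points in one grid box. [this file] -/
theorem card_fibre_le {F : Finset E3} {c : E3} {δ R₀ : ℝ} (hδ : 0 < δ) (hR₀ : 0 < R₀)
    (hsep : ∀ x ∈ F, ∀ y ∈ F, x ≠ y → δ ≤ dist x y) (hFQ : ∀ z ∈ F, ∀ i, c i ≤ z i) (k : Fin 3 → ℕ) :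
    (((F.filter fun z => gridIdx c R₀ z = k).card : ℕ) : ℝ) ≤ (4 * R₀ / δ + 1) ^ 3 := by
  classical
  set P := F.filter fun z => gridIdx c R₀ z = k with hP
  rcases P.eq_empty_or_nonempty with hP0 | ⟨p, hp⟩
  · rw [hP0, card_empty, Nat.cast_zero]; positivity
  · have hpP := mem_filter.1 hp
    have h := card_le_of_separated_of_dist_le P p hδ (by positivity : (0 : ℝ) ≤ 2 * R₀)
      (fun z hz => by
        have hz' := mem_filter.1 hz
        exact dist_le_of_gridIdx_eq hR₀ (hFQ z hz'.1) (hFQ p hpP.1) (hz'.2.trans hpP.2.symm))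
      (fun x hx y hy hxy => hsep x (mem_filter.1 hx).1 y (mem_filter.1 hy).1 hxy)
    rw [finrank_euclideanSpace_fin] at h
    calc (P.card : ℝ) ≤ (2 * (2 * R₀) / δ + 1) ^ 3 := h
      _ = (4 * R₀ / δ + 1) ^ 3 := by ring

/-! ## §2 SHELL PACKING -/

/-- **SHELL PACKING.** The sites of a `δ`-separated `F ⊆ Q(c, ℓ)` within coordinate distance `R₀` of `∂Q` number `≤ 9·(ℓ/R₀ + 1)²·(4R₀/δ + 1)³`. [this file] -/
theorem card_filter_shell_le {F : Finset E3} {c : E3} {δ R₀ ℓ : ℝ} (hδ : 0 < δ) (hR₀ : 0 < R₀) (hℓ : 0 ≤ ℓ)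
    (hsep : ∀ x ∈ F, ∀ y ∈ F, x ≠ y → δ ≤ dist x y) (hFQ : ∀ z ∈ F, ∀ i, c i ≤ z i ∧ z i < c i + ℓ) :
    ((F.filter fun z => ∃ i : Fin 3, z i < c i + R₀ ∨ c i + ℓ - R₀ ≤ z i).card : ℝ) ≤
      9 * (ℓ / R₀ + 1) ^ 2 * (4 * R₀ / δ + 1) ^ 3 := by
  classical
  set K : ℕ := (⌊ℓ / R₀⌋).toNat with hKdef
  have hK0 : 0 ≤ ⌊ℓ / R₀⌋ := Int.floor_nonneg.2 (div_nonneg hℓ hR₀.le)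
  have hKcast : ((K : ℕ) : ℤ) = ⌊ℓ / R₀⌋ := by simp [hKdef, Int.toNat_of_nonneg hK0]
  have hKreal : (K : ℝ) ≤ ℓ / R₀ := by
    have : ((K : ℕ) : ℝ) = ((⌊ℓ / R₀⌋ : ℤ) : ℝ) := by exact_mod_cast hKcast
    rw [this]; exact Int.floor_le _
  set n : ℕ := ⌊(4 * R₀ / δ + 1) ^ 3⌋₊ with hndef
  have hn_real : (n : ℝ) ≤ (4 * R₀ / δ + 1) ^ 3 := Nat.floor_le (by positivity)
  have hn : ∀ P : Finset E3, P ⊆ F → ∀ k, (P.filter fun z => gridIdx c R₀ z = k).card ≤ n := by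
    intro P hP k
    have h1 : (P.filter fun z => gridIdx c R₀ z = k).card ≤ (F.filter fun z => gridIdx c R₀ z = k).card :=
      card_le_card (filter_subset_filter _ hP)
    have h2 := card_fibre_le hδ hR₀ hsep (fun z hz i => (hFQ z hz i).1) k
    exact Nat.le_floor (le_trans (by exact_mod_cast h1) h2)
  -- index facts
  have hidx : ∀ z ∈ F, ∀ i, gridIdx c R₀ z i ≤ K := by
    intro z hz i
    have h1 : ⌊(z i - c i) / R₀⌋ ≤ ⌊ℓ / R₀⌋ :=
      Int.floor_le_floor (div_le_div_of_nonneg_right (by linarith [(hFQ z hz i).2]) hR₀.le)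
    have h2 := gridIdx_cast hR₀ i (hFQ z hz i).1
    omega
  have hlow : ∀ z ∈ F, ∀ i, z i < c i + R₀ → gridIdx c R₀ z i = 0 := by
    intro z hz i hzi
    have h1 : ⌊(z i - c i) / R₀⌋ < 1 := by
      refine Int.floor_lt.2 ?_
      push_cast
      rw [div_lt_one hR₀]; linarith
    have h2 := gridIdx_cast hR₀ i (hFQ z hz i).1
    omega
  have hup : ∀ z ∈ F, ∀ i, c i + ℓ - R₀ ≤ z i → K ≤ gridIdx c R₀ z i + 1 := by
    intro z hz i hzi
    have h1 : ⌊ℓ / R₀⌋ - 1 ≤ ⌊(z i - c i) / R₀⌋ := by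
      rw [← Int.floor_sub_one]
      refine Int.floor_le_floor ?_
      rw [sub_le_iff_le_add, div_le_iff₀ hR₀, add_mul, div_mul_cancel₀ _ hR₀.ne']
      linarith
    have h2 := gridIdx_cast hR₀ i (hFQ z hz i).1
    omega
  -- the six slabs
  set Lo : Fin 3 → Finset E3 := fun i => F.filter fun z => z i < c i + R₀ with hLo
  set Up : Fin 3 → Finset E3 := fun i => F.filter fun z => c i + ℓ - R₀ ≤ z i with hUp
  have hcover : (F.filter fun z => ∃ i : Fin 3, z i < c i + R₀ ∨ c i + ℓ - R₀ ≤ z i) ⊆ univ.biUnion fun i => Lo i ∪ Up i := by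
    intro z hz
    obtain ⟨hzF, i, hi⟩ := mem_filter.1 hz
    rw [mem_biUnion]
    refine ⟨i, mem_univ _, ?_⟩
    rcases hi with hi | hi
    · exact mem_union_left _ (mem_filter.2 ⟨hzF, hi⟩)
    · exact mem_union_right _ (mem_filter.2 ⟨hzF, hi⟩)
  have hLoCard : ∀ i, (Lo i).card ≤ n * (1 * (K + 1) ^ 2) := by
    intro i
    set t : Fin 3 → Finset ℕ := fun j => if j = i then {0} else range (K + 1) with ht
    have hmaps : ∀ z ∈ Lo i, gridIdx c R₀ z ∈ Fintype.piFinset t := by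
      intro z hz
      obtain ⟨hzF, hzi⟩ := mem_filter.1 hz
      rw [Fintype.mem_piFinset]
      intro j
      by_cases hj : j = i
      · subst hj; simp only [ht, if_true, mem_singleton]; exact hlow z hzF j hzi
      · simp only [ht, if_neg hj, mem_range]; exact Nat.lt_succ_of_le (hidx z hzF j)
    have h := card_le_mul_card_image_of_maps_to hmaps n fun k _ => hn (Lo i) (filter_subset _ _) k
    have hcard : (Fintype.piFinset t).card = 1 * (K + 1) ^ 2 := by
      rw [Fintype.card_piFinset, Fin.prod_univ_three]
      fin_cases i <;> simp [ht, card_range] <;> ring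
    rw [hcard] at h
    exact h
  have hUpCard : ∀ i, (Up i).card ≤ n * (2 * (K + 1) ^ 2) := by
    intro i
    set t : Fin 3 → Finset ℕ := fun j => if j = i then {K - 1, K} else range (K + 1) with ht
    have hmaps : ∀ z ∈ Up i, gridIdx c R₀ z ∈ Fintype.piFinset t := by
      intro z hz
      obtain ⟨hzF, hzi⟩ := mem_filter.1 hz
      rw [Fintype.mem_piFinset]
      intro j
      by_cases hj : j = i
      · subst hj
        simp only [ht, if_true, mem_insert, mem_singleton]
        have h1 := hup z hzF j hzi
        have h2 := hidx z hzF j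
        omega
      · simp only [ht, if_neg hj, mem_range]; exact Nat.lt_succ_of_le (hidx z hzF j)
    have h := card_le_mul_card_image_of_maps_to hmaps n fun k _ => hn (Up i) (filter_subset _ _) k
    have hcard : (Fintype.piFinset t).card ≤ 2 * (K + 1) ^ 2 := by
      rw [Fintype.card_piFinset, Fin.prod_univ_three]
      have h2 : ({K - 1, K} : Finset ℕ).card ≤ 2 := card_insert_le _ _
      fin_cases i <;> simp [ht, card_range] <;> nlinarith [h2]
    exact h.trans (Nat.mul_le_mul_left _ hcard)
  -- total
  have htot : (F.filter fun z => ∃ i : Fin 3, z i < c i + R₀ ∨ c i + ℓ - R₀ ≤ z i).card ≤ 9 * n * (K + 1) ^ 2 := by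
    refine (card_le_card hcover).trans ((card_biUnion_le).trans ?_)
    calc ∑ i : Fin 3, (Lo i ∪ Up i).card ≤ ∑ i : Fin 3, (n * (1 * (K + 1) ^ 2) + n * (2 * (K + 1) ^ 2)) :=
          sum_le_sum fun i _ => (card_union_le _ _).trans (Nat.add_le_add (hLoCard i) (hUpCard i))
      _ = 9 * n * (K + 1) ^ 2 := by simp; ring
  have hK1 : ((K : ℕ) : ℝ) + 1 ≤ ℓ / R₀ + 1 := by linarith
  calc ((F.filter fun z => ∃ i : Fin 3, z i < c i + R₀ ∨ c i + ℓ - R₀ ≤ z i).card : ℝ) ≤ 9 * n * ((K : ℝ) + 1) ^ 2 := by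
        exact_mod_cast htot
    _ ≤ 9 * (4 * R₀ / δ + 1) ^ 3 * (ℓ / R₀ + 1) ^ 2 := by
        have hK0' : (0 : ℝ) ≤ (K : ℝ) + 1 := by positivity
        have := pow_le_pow_left₀ hK0' hK1 2
        have hn0 : (0 : ℝ) ≤ n := Nat.cast_nonneg n
        nlinarith [mul_le_mul hn_real this (by positivity) (by positivity)]
    _ = 9 * (ℓ / R₀ + 1) ^ 2 * (4 * R₀ / δ + 1) ^ 3 := by ring

/-! ## §3 BULK COVERING -/

/-- **BULK COVERING.** If every point of space is within `R₁ < 2` of `Y`, the half-open cube `Q(c, ℓ)`, `ℓ ≥ 8`, holds `≥ (ℓ/4 − 2)³` sites of `Y`. [this file] -/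
theorem card_ge_of_covering {Y : Set E3} {R₁ : ℝ} (hR₁ : R₁ < 2) (hcov : ∀ x : E3, ∃ p ∈ Y, dist x p ≤ R₁) {c : E3} {ℓ : ℝ}
    (hℓ : 8 ≤ ℓ) {F : Finset E3} (hF : (↑F : Set E3) = Y ∩ {z | ∀ i : Fin 3, c i ≤ z i ∧ z i < c i + ℓ}) :
    (ℓ / 4 - 2) ^ 3 ≤ (F.card : ℝ) := by
  classical
  have hR₁0 : 0 ≤ R₁ := by obtain ⟨p, -, hp⟩ := hcov c; exact dist_nonneg.trans hp
  set K : ℕ := (⌊ℓ / 4⌋).toNat - 1 with hKdef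
  have hfl2 : (2 : ℤ) ≤ ⌊ℓ / 4⌋ := Int.le_floor.2 (by push_cast; linarith)
  have hKint : ((K : ℕ) : ℤ) = ⌊ℓ / 4⌋ - 1 := by
    have : (((⌊ℓ / 4⌋).toNat : ℕ) : ℤ) = ⌊ℓ / 4⌋ := Int.toNat_of_nonneg (by omega)
    omega
  have hKreal : (K : ℝ) = ((⌊ℓ / 4⌋ : ℤ) : ℝ) - 1 := by exact_mod_cast hKint
  have hKge : ℓ / 4 - 2 ≤ (K : ℝ) := by rw [hKreal]; linarith [Int.sub_one_lt_floor (ℓ / 4)]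
  have hKle : 4 * (K : ℝ) + 4 ≤ ℓ := by
    rw [hKreal]
    have := Int.floor_le (ℓ / 4)
    linarith
  -- centres of the boxes and one site in each
  set x : (Fin 3 → Fin K) → E3 := fun k => WithLp.toLp 2 fun i => c i + (4 * ((k i : ℕ) : ℝ) + 2) with hx
  have hxi : ∀ k i, x k i = c i + (4 * ((k i : ℕ) : ℝ) + 2) := fun k i => rfl
  choose p hpY hpd using fun k => hcov (x k)
  have hpcoord : ∀ k i, |x k i - p k i| ≤ R₁ := fun k i => by
    rw [← Real.dist_eq]; exact (PiLp.dist_apply_le (x k) (p k) i).trans (hpd k)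
  have hpF : ∀ k, p k ∈ F := by
    intro k
    have : p k ∈ (↑F : Set E3) := by
      rw [hF]
      refine ⟨hpY k, fun i => ?_⟩
      have h1 := hpcoord k i
      rw [abs_le, hxi] at h1
      have hk : ((k i : ℕ) : ℝ) + 1 ≤ K := by exact_mod_cast (k i).isLt
      constructor <;> nlinarith
    exact this
  have hpinj : Function.Injective p := by
    intro k k' hkk
    funext i
    have h1 := hpcoord k i
    have h2 := hpcoord k' i
    rw [hkk] at h1
    rw [abs_le, hxi] at h1 h2
    have h3 : |(4 : ℝ) * (((k i : ℕ) : ℝ) - ((k' i : ℕ) : ℝ))| < 4 := by rw [abs_lt]; constructor <;> linarith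
    rw [abs_lt] at h3
    have h4 : ((k i : ℕ) : ℝ) < (k' i : ℕ) + 1 := by linarith
    have h5 : ((k' i : ℕ) : ℝ) < (k i : ℕ) + 1 := by linarith
    have h6 : (k i : ℕ) = (k' i : ℕ) := by
      have := (show ((k i : ℕ) : ℝ) < (((k' i : ℕ) + 1 : ℕ) : ℝ) by push_cast; exact h4)
      have := (show ((k' i : ℕ) : ℝ) < (((k i : ℕ) + 1 : ℕ) : ℝ) by push_cast; exact h5)
      have a1 : (k i : ℕ) < (k' i : ℕ) + 1 := by exact_mod_cast h4
      have a2 : (k' i : ℕ) < (k i : ℕ) + 1 := by exact_mod_cast h5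
      omega
    exact Fin.ext h6
  have hcard : (univ.image p).card = K ^ 3 := by
    rw [card_image_of_injective _ hpinj, card_univ, Fintype.card_fun, Fintype.card_fin, Fintype.card_fin]
  have hsub : univ.image p ⊆ F := fun q hq => by
    obtain ⟨k, -, rfl⟩ := mem_image.1 hq
    exact hpF k
  have hle := card_le_card hsub
  rw [hcard] at hle
  have h0 : 0 ≤ ℓ / 4 - 2 := by linarith
  calc (ℓ / 4 - 2) ^ 3 ≤ (K : ℝ) ^ 3 := pow_le_pow_left₀ h0 hKge 3
    _ ≤ F.card := by exact_mod_cast hle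

end Summit.AtomisticToContinuum.Crystallization.Theorems.OverbindingBudgetEnergyCubeCounting

end
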